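import Literature.NumberTheory.GaloisRepresentations.LocalFieldCountableExtensions
import Literature.NumberTheory.GaloisRepresentations.LocalFieldPadicProofs
import HarnessLib

/-!
# The absolute Galois group of a `p`-adic field is second countable ("Galois-countable")

For a non-archimedean local field `F` of characteristic `0` (in particular `F = ℚ_p`) the profinite group
`Γ_F = Gal(F̄/F)` has COUNTABLY many open subgroups (tree:
`countable_openSubgroup_of_isNonarchimedeanLocalField`, via Krasner's lemma).  We PROVE the two standard
consequences that the anabelian / Frobenioid files of the tree consume as hypotheses:

* `secondCountableTopology_of_countable_openSubgroup` — a compact group with countably many open subgroups, in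
  which the open subgroups form a neighbourhood basis of `1`, is second countable (the left cosets `σ·V` of the
  open subgroups form a countable basis of the topology; Neukirch, *Algebraic Number Theory*, Ch. IV §1, Krull
  topology). [cite: NeukirchANT1999, Ch. IV §1]
* `secondCountableTopology_absoluteGaloisGroup_of_isNonarchimedeanLocalField` — hence `Γ_F` is second countable;
  `Padic.secondCountableTopology_absoluteGaloisGroup` — in particular `G_{ℚ_p}` is;
* `exists_antitone_cofinal_openNormalSubgroup_of_isNonarchimedeanLocalField` /
  `Padic.exists_antitone_cofinal_openNormalSubgroup` — a decreasing sequence `N₀ ⊇ N₁ ⊇ ⋯` of open normal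
  subgroups of `Γ_F` (resp. `G_{ℚ_p}`) cofinal in the neighbourhood filter of `1` (the "universal pro-covering"
  `(Γ_F/N_k)_k`; [SemiAnbd] Rmk. 3.1.2: tempered groups in loc. cit. are Galois-countable).
  [cite: MochizukiSemiAnbd2006, Rmk 3.1.2 p.33]
Everything is proved; no named facts, no instances declared (invoke with `haveI`).
-/

noncomputable section

open Field Topology Filter TopologicalSpace

universe u

namespace Literature.NumberTheory.GaloisRepresentations

/-! ### Compact groups with countably many open subgroups -/

section General

variable {G : Type*} [Group G] [TopologicalSpace G] [IsTopologicalGroup G] [CompactSpace G]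

omit [TopologicalSpace G] [IsTopologicalGroup G] [CompactSpace G] in
/-- The fibre of `G → G/V` over the class of `x` is the left coset `{y | x⁻¹ y ∈ V}`. [folklore] -/
private theorem preimage_mk_singleton_eq (V : Subgroup G) (x : G) :
    (QuotientGroup.mk ⁻¹' {(QuotientGroup.mk x : G ⧸ V)} : Set G) = (fun y => x⁻¹ * y) ⁻¹' (V : Set G) := by
  ext y
  simp only [Set.mem_preimage, Set.mem_singleton_iff, SetLike.mem_coe, QuotientGroup.eq]
  constructor <;> intro h <;> simpa using V.inv_mem h

/-- **A compact group with countably many open subgroups forming a neighbourhood basis of `1` is second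
countable**: the fibres of the finite quotients `G → G/V`, `V` open, form a countable basis of the topology.
[cite: NeukirchANT1999, Ch. IV §1] -/
theorem secondCountableTopology_of_countable_openSubgroup [Countable (OpenSubgroup G)]
    (hbasis : ∀ s ∈ 𝓝 (1 : G), ∃ V : OpenSubgroup G, (V : Set G) ⊆ s) :
    SecondCountableTopology G := by
  let B : Set (Set G) :=
    ⋃ V : OpenSubgroup G, Set.range fun q : G ⧸ (V : Subgroup G) => QuotientGroup.mk ⁻¹' {q}
  have hBc : B.Countable := by
    refine Set.countable_iUnion fun V => ?_
    haveI : Finite (G ⧸ (V : Subgroup G)) := Subgroup.quotient_finite_of_isOpen _ V.isOpen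
    exact Set.countable_range _
  have hBb : IsTopologicalBasis B := by
    refine isTopologicalBasis_of_isOpen_of_nhds ?_ ?_
    · rintro u ⟨-, ⟨V, rfl⟩, ⟨q, rfl⟩⟩
      induction q using QuotientGroup.induction_on with
      | H x =>
        change IsOpen (QuotientGroup.mk ⁻¹' {(QuotientGroup.mk x : G ⧸ (V : Subgroup G))})
        rw [preimage_mk_singleton_eq]
        exact V.isOpen.preimage (continuous_const.mul continuous_id)
    · intro x u hx hu
      have h1 : (fun y => x * y) ⁻¹' u ∈ 𝓝 (1 : G) :=
        (hu.preimage (continuous_const.mul continuous_id)).mem_nhds (by simpa using hx)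
      obtain ⟨V, hV⟩ := hbasis _ h1
      refine ⟨QuotientGroup.mk ⁻¹' {(QuotientGroup.mk x : G ⧸ (V : Subgroup G))},
        Set.mem_iUnion.2 ⟨V, ⟨QuotientGroup.mk x, rfl⟩⟩, rfl, ?_⟩
      intro y hy
      rw [preimage_mk_singleton_eq] at hy
      have : x * (x⁻¹ * y) ∈ u := hV hy
      simpa using this
  exact hBb.secondCountableTopology hBc

end General

/-! ### The absolute Galois group of a non-archimedean local field of characteristic `0` -/

section LocalField

variable (F : Type u) [Field F] [ValuativeRel F] [TopologicalSpace F] [IsNonarchimedeanLocalField F] [CharZero F]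

/-- In `Γ_F = Gal(F̄/F)` the open subgroups form a neighbourhood basis of `1` (Krull topology: every
neighbourhood of `1` contains `Gal(F̄/E)` for a finite subextension `E`, which is open). [cite: NeukirchANT1999, Ch. IV §1] -/
theorem exists_openSubgroup_subset_of_mem_nhds_absoluteGaloisGroup {K : Type u} [Field K]
    (s : Set (absoluteGaloisGroup K)) (hs : s ∈ 𝓝 (1 : absoluteGaloisGroup K)) :
    ∃ V : OpenSubgroup (absoluteGaloisGroup K), (V : Set (absoluteGaloisGroup K)) ⊆ s := by
  obtain ⟨E, hEfd, hEs⟩ := (krullTopology_mem_nhds_one_iff K (AlgebraicClosure K) s).1 hs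
  haveI := hEfd
  exact ⟨⟨E.fixingSubgroup, E.fixingSubgroup_isOpen⟩, hEs⟩

/-- **`Γ_F` is second countable** ("Galois-countable") for a non-archimedean local field `F` of characteristic `0`:
compact, countably many open subgroups (`countable_openSubgroup_of_isNonarchimedeanLocalField`, Krasner), open
subgroups a basis of neighbourhoods of `1`. [cite: NeukirchANT1999, Ch. IV §1] -/
theorem secondCountableTopology_absoluteGaloisGroup_of_isNonarchimedeanLocalField :
    SecondCountableTopology (absoluteGaloisGroup F) := by
  haveI := countable_openSubgroup_of_isNonarchimedeanLocalField F
  exact secondCountableTopology_of_countable_openSubgroup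
    (exists_openSubgroup_subset_of_mem_nhds_absoluteGaloisGroup (K := F))

/-- **A cofinal decreasing sequence of open normal subgroups of `Γ_F`**, packaged as `OpenNormalSubgroup`s:
`N₀ ⊇ N₁ ⊇ ⋯`, every neighbourhood of `1` contains some `N_k` (the universal pro-covering `(Γ_F/N_k)_k` of
`𝓑(Γ_F)⁰`; tempered groups of [SemiAnbd] §3 are Galois-countable, Rmk. 3.1.2). [cite: MochizukiSemiAnbd2006, Rmk 3.1.2 p.33] -/
theorem exists_antitone_cofinal_openNormalSubgroup_of_isNonarchimedeanLocalField :
    ∃ N : ℕ → OpenNormalSubgroup (absoluteGaloisGroup F), Antitone N ∧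
      ∀ s ∈ 𝓝 (1 : absoluteGaloisGroup F), ∃ k, (N k : Set (absoluteGaloisGroup F)) ⊆ s := by
  obtain ⟨U, hUn, hUo, hUanti, -, hUcof⟩ :=
    exists_antitone_openNormal_seq_le_of_isNonarchimedeanLocalField F ⊤ isOpen_univ
  refine ⟨fun k => ⟨⟨U k, hUo k⟩, hUn k⟩, fun j k hjk => ?_, fun s hs => ?_⟩
  · change U k ≤ U j
    exact hUanti hjk
  · obtain ⟨V, hV⟩ := exists_openSubgroup_subset_of_mem_nhds_absoluteGaloisGroup (K := F) s hs
    obtain ⟨k, hk⟩ := hUcof V V.isOpen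
    exact ⟨k, fun σ hσ => hV (hk hσ)⟩

end LocalField

/-! ### `G_{ℚ_p}` -/

namespace Padic

variable (p : ℕ) [Fact p.Prime]

/-- **`G_{ℚ_p}` is second countable** (Galois-countable): `ℚ_p` is a non-archimedean local field of characteristic
`0` (tree `Padic.isNonarchimedeanLocalField_holds`). [cite: NeukirchANT1999, Ch. IV §1] -/
theorem secondCountableTopology_absoluteGaloisGroup : SecondCountableTopology (absoluteGaloisGroup ℚ_[p]) := by
  haveI : IsNonarchimedeanLocalField ℚ_[p] := isNonarchimedeanLocalField_holds p
  exact secondCountableTopology_absoluteGaloisGroup_of_isNonarchimedeanLocalField ℚ_[p]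

/-- **The universal pro-covering of `𝓑(G_{ℚ_p})⁰`**: a decreasing sequence of open normal subgroups of `G_{ℚ_p}`
cofinal in the neighbourhoods of `1`. [cite: MochizukiSemiAnbd2006, Rmk 3.1.2 p.33] -/
theorem exists_antitone_cofinal_openNormalSubgroup :
    ∃ N : ℕ → OpenNormalSubgroup (absoluteGaloisGroup ℚ_[p]), Antitone N ∧
      ∀ s ∈ 𝓝 (1 : absoluteGaloisGroup ℚ_[p]), ∃ k, (N k : Set (absoluteGaloisGroup ℚ_[p])) ⊆ s := by
  haveI : IsNonarchimedeanLocalField ℚ_[p] := isNonarchimedeanLocalField_holds p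
  exact exists_antitone_cofinal_openNormalSubgroup_of_isNonarchimedeanLocalField ℚ_[p]

end Padic

end Literature.NumberTheory.GaloisRepresentations

end
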